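import Summits.QuantumFields.YangMills.Theorems.BalabanUVNodesN15KingModelOSReflectionPositivity
import Literature.MathematicalPhysics.QuantumFieldTheory.OSReconstructionLattice

/-!
# BalabanUVNodes ∕ N15 — THE KING-MODEL RUNG (PART Ͳ-c₂): THE OSTERWALDER–SCHRADER RECONSTRUCTION OF KING's INFINITE-VOLUME BLOCK FIELD `μ_∞`, BY NAME —
# `μ_∞` IS AN `IsRPMeasureData` AND THE TREE's RECONSTRUCTION GIVES ITS TRANSFER OPERATOR (a positive self-adjoint contraction with vacuum on the OS Hilbert space) REALISING `μ_∞`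
# (Track A, DAG node N15 = NE2; FAN-OUT v1.1 §N15 s3 «KING-MODEL RUNG»; count-neutral)

HONEST FRAMING.  Count-neutral (cell `pub-ymgap`, seat `pub-ymgap-dag-n15-e` g36; `--supports stmt-QuantumFields-27366 --as helper` = K3⁸).  King's `A = 0`, `g = 0` model
([King1986] C. King, Commun. Math. Phys. **102** (1986) 649–677): the FREE massive block field `μ_∞ = N(0, S₂^{ℝ}(w − z))` on `ℝ^{ℤ^{d+1}}` of part Ϻ-n, with the tree's lattice OS data
(time reflection between sites `θ`, unit time shift `S`, positive-time σ-algebra `𝓔₊`; `Literature.MathematicalPhysics.QuantumFieldTheory.LatticeMassGap`).  Part Ͳ-c₁ proved every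
premise; here they are ASSEMBLED BY NAME: ★★★ **`μ_∞` IS AN `IsRPMeasureData`** (`king_isRPMeasureData`, the tree's `isRPMeasureData_lattice`), hence ★★★ **THE OSTERWALDER–SCHRADER
RECONSTRUCTION OF `μ_∞` EXISTS BY NAME**: `king_isOSRealisation : IsOSRealisation μ_∞ θ* S 𝓔₊ (rpMap h) (rpTransferData h h₊)` — the OS Hilbert space `ℋ = closure(𝓔₊∕𝒩)`, the OS map `ι`
and the TRANSFER OPERATOR `T` (a POSITIVE self-adjoint CONTRACTION fixing the unit VACUUM `Ω = ι 1`; `ι(G ∘ S) = T ιG`; `⟪ιF, ιG⟫ = ∫ conj F(φ∘θ) G(φ) dμ_∞`; dense range) are the tree's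
construction `Literature.Probability.LatticeModels.isOSRealisation_of_isRPMeasureData` fed King's measure, the ONE-step operator being positive by Ͳ-c₁'s `king_shift_nonneg`.
So the hypothesis «`(H, ι, D)` realises `μ`» of the tree's `latticeClustering_iff_gap` ∕ `timeClustering_iff_massGap` is INHABITED for King's block field, by construction.
NOT Bałaban's objects; NOT a node discharge; the transfer operator is that of King's FREE block field, nothing about Yang–Mills ∕ continuum ∕ `ℝ⁴` ∕ Clay.  0 `sorry`, 0 def; standard axioms.

WHAT THIS FILE PROVES (kernel).  ★★★ **`king_isRPMeasureData`**, ★★★ **`king_isOSRealisation`**, ★★ `king_inner_rpMap`, ★★ `king_rpMap_comp_shift`, `king_transfer_isPositive`,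
`king_transfer_norm_le_one`, `king_transfer_vacuum`.

HONEST SCOPE.  King's free infinite-volume block field only (`m² > 0`, every `d`).  N15 untouched; counts unmoved.
Locators (use): [King1986] Thm 2.1 (2.22)–(2.23) p.654, (4.5) p.670; Glimm–Jaffe 1987 §6.1 Thm. 6.1.3; Osterwalder–Seiler 1978 §2.
-/

noncomputable section

open scoped BigOperators
open MeasureTheory ProbabilityTheory Finset

namespace Summit.QuantumFields.YangMills.BalabanUVNodes.N15KingModelRung.InfiniteVolume

open Literature.MathematicalPhysics.QuantumFieldTheory (latticeTimeReflection positiveTimeSites positiveTimeEvents latticeTimeShift isRPMeasureData_lattice)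
open Literature.Probability.LatticeModels (configReflect IsBoundedMeasurable IsRPMeasureData IsOSRealisation TransferData rpMap rpTransferData
  isOSRealisation_of_isRPMeasureData)

variable {d : ℕ}

/-- ★★★ **`μ_∞` IS AN `IsRPMeasureData`** for the tree's lattice OS data (time reflection between sites, unit time shift, positive-time σ-algebra): all premises of the
Osterwalder–Schrader reconstruction hold for King's infinite-volume block field. [cite: King1986, Thm 2.1 (2.22) p.654; GlimmJaffe1987, §6.1 Thm. 6.1.3; OsterwalderSeiler1978, §2] -/
theorem king_isRPMeasureData {m2 : ℝ} (hm : 0 < m2) :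
    IsRPMeasureData (kingFieldInf (d := d) m2) (configReflect (latticeTimeReflection (d + 1))) (latticeTimeShift (d + 1) ℝ) (positiveTimeEvents (d + 1) ℝ) := by
  haveI := isProbabilityMeasure_kingFieldInf (d := d) hm
  exact isRPMeasureData_lattice _ (king_isReflectionInvariant hm) (king_measurePreserving_latticeTimeShift hm) (king_isReflectionPositive hm)

/-! ## §4 The Osterwalder–Schrader reconstruction of `μ_∞`, by name -/

/-- ★★★ **THE OSTERWALDER–SCHRADER RECONSTRUCTION OF KING's INFINITE-VOLUME BLOCK FIELD**: the OS Hilbert space of the reflected pairing, the OS map `ι` and the reconstructed transfer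
data `(T, Ω)` — the TREE's construction `isOSRealisation_of_isRPMeasureData` — REALISE `μ_∞`: `⟪ι F, ι G⟫ = ∫ conj F(φ∘θ) G(φ) dμ_∞` on bounded positive-time observables, `ι(G ∘ S) = T(ι G)`,
`ι 1 = Ω`, dense range; `T` is a positive self-adjoint contraction fixing the unit vacuum `Ω`. [cite: King1986, Thm 2.1 (2.22) p.654; GlimmJaffe1987, §6.1 Thm. 6.1.3; OsterwalderSeiler1978, §2] -/
theorem king_isOSRealisation {m2 : ℝ} (hm : 0 < m2) :
    IsOSRealisation (kingFieldInf (d := d) m2) (configReflect (latticeTimeReflection (d + 1))) (latticeTimeShift (d + 1) ℝ) (positiveTimeEvents (d + 1) ℝ)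
      (rpMap (king_isRPMeasureData hm)) (rpTransferData (king_isRPMeasureData hm) (king_shift_nonneg hm)) :=
  isOSRealisation_of_isRPMeasureData _ _

/-- ★★ The OS inner product of King's block field IS the reflected pairing: `⟪ι F, ι G⟫ = ∫ conj F(φ∘θ)·G(φ) dμ_∞`. [cite: GlimmJaffe1987, §6.1 (6.1.12)] -/
theorem king_inner_rpMap {m2 : ℝ} (hm : 0 < m2) {F G : ((Fin (d + 1) → ℤ) → ℝ) → ℂ} (hF : IsBoundedMeasurable (positiveTimeEvents (d + 1) ℝ) F)
    (hG : IsBoundedMeasurable (positiveTimeEvents (d + 1) ℝ) G) :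
    inner ℂ (rpMap (king_isRPMeasureData (d := d) hm) F) (rpMap (king_isRPMeasureData hm) G)
      = ∫ ω, starRingEnd ℂ (F (configReflect (latticeTimeReflection (d + 1)) ω)) * G ω ∂kingFieldInf m2 :=
  (king_isOSRealisation hm).inner_eq F G hF hG

/-- ★★ The unit time shift of King's block field IS implemented by the transfer operator: `ι(G ∘ S) = T(ι G)`. [cite: GlimmJaffe1987, §6.1 Thm. 6.1.3] -/
theorem king_rpMap_comp_shift {m2 : ℝ} (hm : 0 < m2) {G : ((Fin (d + 1) → ℤ) → ℝ) → ℂ} (hG : IsBoundedMeasurable (positiveTimeEvents (d + 1) ℝ) G) :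
    rpMap (king_isRPMeasureData (d := d) hm) (G ∘ latticeTimeShift (d + 1) ℝ)
      = (rpTransferData (king_isRPMeasureData hm) (king_shift_nonneg hm)).T (rpMap (king_isRPMeasureData hm) G) :=
  (king_isOSRealisation hm).map_shift G hG

/-- The transfer operator of King's block field is a positive operator (in particular self-adjoint). [cite: GlimmJaffe1987, §6.1 Thm. 6.1.3] -/
theorem king_transfer_isPositive {m2 : ℝ} (hm : 0 < m2) :
    (rpTransferData (king_isRPMeasureData (d := d) hm) (king_shift_nonneg hm)).T.IsPositive :=
  (rpTransferData _ _).isPositive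

/-- The transfer operator of King's block field is a contraction. [cite: GlimmJaffe1987, §6.1 Thm. 6.1.3 (iii)] -/
theorem king_transfer_norm_le_one {m2 : ℝ} (hm : 0 < m2) :
    ‖(rpTransferData (king_isRPMeasureData (d := d) hm) (king_shift_nonneg hm)).T‖ ≤ 1 :=
  (rpTransferData _ _).norm_le_one

/-- The transfer operator of King's block field fixes the unit vacuum `Ω = ι 1`. [cite: GlimmJaffe1987, §6.1 Thm. 6.1.3] -/
theorem king_transfer_vacuum {m2 : ℝ} (hm : 0 < m2) :
    (rpTransferData (king_isRPMeasureData (d := d) hm) (king_shift_nonneg hm)).T (rpTransferData (king_isRPMeasureData hm) (king_shift_nonneg hm)).vacuum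
        = (rpTransferData (king_isRPMeasureData hm) (king_shift_nonneg hm)).vacuum
      ∧ ‖(rpTransferData (king_isRPMeasureData (d := d) hm) (king_shift_nonneg hm)).vacuum‖ = 1
      ∧ rpMap (king_isRPMeasureData (d := d) hm) 1 = (rpTransferData (king_isRPMeasureData hm) (king_shift_nonneg hm)).vacuum :=
  ⟨(rpTransferData _ _).map_vacuum, (rpTransferData _ _).norm_vacuum, (king_isOSRealisation hm).map_one⟩

end Summit.QuantumFields.YangMills.BalabanUVNodes.N15KingModelRung.InfiniteVolume
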